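import Summits.QuantumFields.BalabanUV.Beta.GAN24.PlantedTwoWordLaw

/-!
# `BalabanUV.Beta.GAN24.NestedTwoVertexWordRate` — binder row G-an2-4 ∕ (CONV-C), routes C-R6° («VALUES») × R7 («TWO CURRENCIES»), PART 222:
# THE THREE-POINT STEP ENVELOPE OF THE TWO-VERTEX WORD `X_{[i,j],k} = avgTow(𝒢P_i𝒢P_j𝒢)` FOR TWO BOUNDED, EXACTLY NESTED, LOCALISED SINGLE-DIRECTION BACKGROUNDS — PART 204 §4
# WITHOUT THE LIPSCHITZ LETTER: operator-norm tower rate `L^{−k}` by PART 221's planted two-word law, interpolated with PART 204 §3's three-point (UD)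
# (unit b2b-balaban-gan24-p3, gen 63; v1)

NOT IN PRINT; OUR PROOF ([folklore] bookkeeping BY NAME over PART 221 (`towerLimitRate_plantedTwoWord`), PART 219 (`Pmodel_single`, `diagonal_nested`), PART 218 (`plantedG_le_lev`,
`plantedW_le_lev`, `pairingW_le_lev`), PART 204 (`exists_threePoint_twoVertexWord` — bounded, no smoothness), the t4-ne2-p1 lineage's `freeTowerLaws_balaban`, `KingPairingPlantedLaw`,
`BlockPairingGeometry` (`JK_mul_diagonal`, `opNorm_diagonal_le`), `DecayRateInterpolation.decayRate_of_towerLimitRate`, b05's `B5Prop11Plancherel` (`opNorm_calG_le`, `opNorm_fdiff_calG_le`);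
nothing printed is a hypothesis).
HONEST FRAMING (cell contract, verbatim): «discharging `BetaPertH` makes Bałaban's UV stability UNCONDITIONAL — a real constructive-QFT result; it is NOT the
continuum limit and NOT the Clay problem.»  HONEST DEPENDENCY (verbatim): «continuum YM on T⁴ ⇐ BetaPertH ∧ nine spine estimates (0/9 proved); BetaPertH ⇐
(D1) ∧ (D4) ∧ CAP+tail; G-an2-4 gates asym, D1 and NE2/3/4.»

WHAT THIS FILE PROVES (0 sorry, 0 `def`):
* §1 **`towerLimitRate_nestedTwoWord`** — (`L ≥ 2`; `V₁, V₂` bounded by `α`, single directions `μ₁, μ₂`, exactly nested; EVERY torus)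
  `TowerLimitRate (QBlev L M) (L^d) (k ↦ 𝒢_kP_{1,k}(𝒢_kP_{2,k}𝒢_k)) C L^{−1}` with an explicit `C(d, L, a, α)`.
* §2 **`exists_threePoint_twoVertexWord_rate_nested`** — `∃ κ > 0, B, B′ ≥ 0` from `(d, L, a, α, c₀)`: on EVERY torus, for all unit bonds `i, j`, directions `μ₁, μ₂`, bounded nested
  single-direction `V₁, V₂` supported where `ρ_{k,i} ≤ c₀` resp. `ρ_{k,j} ≤ c₀`: `‖X_{[i,j],k}(x,y)‖ ≤ B·e^{−κD}` and `‖(X_{[i,j],k+1} − X_{[i,j],k})(x,y)‖ ≤ B′(√(L⁻¹))^k e^{−κD}`,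
  `D = distK(x,i) + distK(i,j) + distK(y,j)`.
WHAT IT DOES NOT DO: the tadpole bundles and the END (PART 223).
SUPPLIER work; NEVER «G-an2-4 closed»; NOT (CONV-C), NOT D1, NOT `BetaPertH`, NOT continuum, NOT Clay.  Records: `HOME/b2b-balaban-gan24-p3/gen63/README.md`.
-/

noncomputable section

open scoped BigOperators ComplexConjugate Matrix Matrix.Norms.L2Operator
open Filter Topology

namespace Summit.QuantumFields.BalabanUV.Beta.GAN24.NestedTwoVertexWordRate

open Literature.MathematicalPhysics.QuantumFieldTheory.Balaban1983to89
open Literature.MathematicalPhysics.QuantumFieldTheory.Balaban1983to89.B5Prop11Plancherel (Tor fine Cst Cst_nonneg fdiff calG opNorm_calG_le opNorm_fdiff_calG_le)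
open Literature.MathematicalPhysics.QuantumFieldTheory.Balaban1983to89.B5G183RateTorusW (CQL)
open Literature.MathematicalPhysics.QuantumFieldTheory.Balaban1983to89.B5G183RateUnitTower (lev)
open Summit.QuantumFields.BalabanUV.T4Continuum
open Summit.QuantumFields.BalabanUV.T4Continuum.CovariantAveragingTower (avgTow TowerLimitRate)
open Summit.QuantumFields.BalabanUV.T4Continuum.BalabanAveragedTowerUnit (idx QBlev calGlev one_le_lev')
open Summit.QuantumFields.BalabanUV.T4Continuum.BalabanAveragingPairing (FQBlev freeTowerLaws_balaban)
open Summit.QuantumFields.BalabanUV.T4Continuum.KingPairingPlantedLaw (JpcT calDalev calDalev_inv CJ CJ_nonneg JK_conjTranspose_mul_JK)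
open Summit.QuantumFields.BalabanUV.T4Continuum.BlockPairingGeometry (parT JK_mul_diagonal opNorm_diagonal_le)
open Summit.QuantumFields.BalabanUV.T4Continuum.FirstOrderBackgroundModel (Pmodel)
open Summit.QuantumFields.BalabanUV.T4Continuum.CTKingTowerWeights (rho distK)
open Summit.QuantumFields.BalabanUV.T4Continuum.DecayRateInterpolation (EntryDecay TwoLevelDecayRate decayRate_of_towerLimitRate)
open Summit.QuantumFields.BalabanUV.Beta.GAN24.UnitLatticeDecayAlgebra (distK_nonneg)
open Summit.QuantumFields.BalabanUV.Beta.GAN24.TwoVertexWordThreePointDecay (exists_threePoint_twoVertexWord)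
open Summit.QuantumFields.BalabanUV.Beta.GAN24.DerivativeItemPlantedLaw (plantedG_le_lev plantedW_le_lev pairingW_le_lev)
open Summit.QuantumFields.BalabanUV.Beta.GAN24.NestedBackgroundWordRate (Pmodel_single diagonal_nested)
open Summit.QuantumFields.BalabanUV.Beta.GAN24.PlantedTwoWordLaw (towerLimitRate_plantedTwoWord)

variable {d : ℕ} (L : ℕ) [NeZero L] (M : Fin d → ℕ) [hM : ∀ μ, NeZero (M μ)] (a : ℝ) (ha : 0 < a)

/-! ## §1 The tower rate of the two-vertex word in operator norm -/

/-- **`towerLimitRate_nestedTwoWord` — THE TWO-VERTEX WORD OF TWO BOUNDED NESTED SINGLE-DIRECTION BACKGROUNDS CONVERGES ALONG BAŁABAN's TOWER WITH RATE `L^{−k}` IN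
OPERATOR NORM** [our proof] (`L ≥ 2`; `‖Vᵢ‖ ≤ α`, single directions `μ₁`, `μ₂` (possibly different), nested; EVERY torus) — PART 221 on `freeTowerLaws_balaban` with PART 218's letters; NO smoothness. -/
theorem towerLimitRate_nestedTwoWord (hL : 2 ≤ L) {α : ℝ} (hα : 0 ≤ α) {V₁ V₂ : (k : ℕ) → Fin d → (idx L M k → ℂ)} {μ₁ μ₂ : Fin d}
    (hb₁ : ∀ k μ u, ‖V₁ k μ u‖ ≤ α) (hd₁ : ∀ k μ u, μ ≠ μ₁ → V₁ k μ u = 0) (hn₁ : ∀ k (u : idx L M (k + 1)), V₁ (k + 1) μ₁ u = V₁ k μ₁ (parT (lev L k) L M u))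
    (hb₂ : ∀ k μ u, ‖V₂ k μ u‖ ≤ α) (hd₂ : ∀ k μ u, μ ≠ μ₂ → V₂ k μ u = 0) (hn₂ : ∀ k (u : idx L M (k + 1)), V₂ (k + 1) μ₂ u = V₂ k μ₂ (parT (lev L k) L M u)) :
    TowerLimitRate (QBlev L M) ((L : ℝ) ^ d) (fun k => calGlev L M a ha k * Pmodel L M V₁ k * (calGlev L M a ha k * Pmodel L M V₂ k * calGlev L M a ha k))
      ((α * Cst d a) * (α * Cst d a) * CJ d a + (Cst d a * α * (α * Cst d a) + Cst d a * α * Cst d a * α) * (CQL d a + 4 * d * Cst d a)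
        + (α * Cst d a) * (α * Cst d a) * (d * L * Cst d a) + Cst d a * α * Cst d a * α * (d * L * Cst d a)) ((L : ℝ)⁻¹) := by
  have hL1 : (1 : ℝ) < L := by exact_mod_cast (lt_of_lt_of_le one_lt_two hL : 1 < L)
  have hr : (0 : ℝ) < (L : ℝ) ^ d := pow_pos (lt_trans zero_lt_one hL1) d
  have hρ1 : ((L : ℝ)⁻¹) < 1 := inv_lt_one_of_one_lt₀ hL1
  have hT := towerLimitRate_plantedTwoWord (Δ := calDalev L M a ha) (D₁ := fun k => Matrix.diagonal (V₁ k μ₁)) (D₂ := fun k => Matrix.diagonal (V₂ k μ₂))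
    (W₁ := fun k => fdiff (fine (lev L k) M) ((lev L k : ℕ) : ℂ) μ₁ * (calDalev L M a ha k)⁻¹)
    (W₂ := fun k => fdiff (fine (lev L k) M) ((lev L k : ℕ) : ℂ) μ₂ * (calDalev L M a ha k)⁻¹) hr (freeTowerLaws_balaban L M a ha)
    (fun k => JK_conjTranspose_mul_JK (lev L k) L M)
    (fun k => by
      show Matrix.diagonal (V₁ (k + 1) μ₁) * JpcT L M k = JpcT L M k * Matrix.diagonal (V₁ k μ₁)
      rw [diagonal_nested L M hn₁ k]; exact (JK_mul_diagonal (lev L k) L M (V₁ k μ₁)).symm)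
    (fun k => by
      show Matrix.diagonal (V₂ (k + 1) μ₂) * JpcT L M k = JpcT L M k * Matrix.diagonal (V₂ k μ₂)
      rw [diagonal_nested L M hn₂ k]; exact (JK_mul_diagonal (lev L k) L M (V₂ k μ₂)).symm)
    (fun k => by rw [calDalev_inv]; exact opNorm_calG_le (lev L k) (one_le_lev' L k) M a ha)
    (fun k => opNorm_diagonal_le (fine (lev L k) M) hα fun u => hb₁ k μ₁ u)
    (fun k => opNorm_diagonal_le (fine (lev L k) M) hα fun u => hb₂ k μ₂ u)
    (fun k => by rw [calDalev_inv]; exact opNorm_fdiff_calG_le (lev L k) (one_le_lev' L k) M a ha μ₁)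
    (fun k => by rw [calDalev_inv]; exact opNorm_fdiff_calG_le (lev L k) (one_le_lev' L k) M a ha μ₂)
    (fun k => by rw [calDalev_inv, calDalev_inv]; exact plantedG_le_lev L M a ha k)
    (fun k => by rw [calDalev_inv, calDalev_inv]; exact plantedW_le_lev L M a ha k μ₁)
    (fun k => by rw [calDalev_inv, calDalev_inv]; exact plantedW_le_lev L M a ha k μ₂)
    (fun k => by rw [calDalev_inv]; exact pairingW_le_lev L M a ha k μ₂)
    hρ1 (fun k => le_rfl) (fun k => le_rfl) (fun k => le_rfl) (fun k => le_rfl)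
  have e : (fun k => (calDalev L M a ha k)⁻¹ * Matrix.diagonal (V₁ k μ₁) * (fdiff (fine (lev L k) M) ((lev L k : ℕ) : ℂ) μ₁ * (calDalev L M a ha k)⁻¹)
      * Matrix.diagonal (V₂ k μ₂) * (fdiff (fine (lev L k) M) ((lev L k : ℕ) : ℂ) μ₂ * (calDalev L M a ha k)⁻¹))
      = fun k => calGlev L M a ha k * Pmodel L M V₁ k * (calGlev L M a ha k * Pmodel L M V₂ k * calGlev L M a ha k) := by
    funext k; rw [calDalev_inv, Pmodel_single L M hd₁ k, Pmodel_single L M hd₂ k]; simp only [Matrix.mul_assoc]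
  rw [e] at hT
  exact hT

/-! ## §2 The three-point level and step envelopes for nested bounded pairs -/

/-- **`exists_threePoint_twoVertexWord_rate_nested` — THE LEVEL AND STEP ENVELOPES OF THE TWO-VERTEX WORD OF TWO BOUNDED, EXACTLY NESTED, LOCALISED SINGLE-DIRECTION
BACKGROUNDS, VOLUME-FREE** [our proof] (`L ≥ 2`, `α ≥ 0`, `c₀` arbitrary): `∃ κ > 0, B, B′ ≥ 0` from `(d, L, a, α, c₀)` such that on EVERY torus, for all unit bonds
`i, j`, directions `μ₁, μ₂` and all families `V₁, V₂` bounded by `α`, vanishing off their directions, nested, supported where `ρ_{k,i} ≤ c₀` resp. `ρ_{k,j} ≤ c₀`, and all `k, x, y`: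
`‖X_{[i,j],k}(x,y)‖ ≤ B·e^{−κD}` and `‖(X_{[i,j],k+1} − X_{[i,j],k})(x,y)‖ ≤ B′·(√(L⁻¹))^k·e^{−κD}`, `D = distK(x,i) + distK(i,j) + distK(y,j)` — PART 204 §3 interpolated with §1 by
`decayRate_of_towerLimitRate`. -/
theorem exists_threePoint_twoVertexWord_rate_nested (hL : 2 ≤ L) (α c₀ : ℝ) (hα : 0 ≤ α) :
    ∃ κ B B' : ℝ, 0 < κ ∧ 0 ≤ B ∧ 0 ≤ B' ∧ ∀ (M : Fin d → ℕ) [∀ μ, NeZero (M μ)] (i j : idx L M 0) (μ₁ μ₂ : Fin d) (V₁ V₂ : (k : ℕ) → Fin d → (idx L M k → ℂ)),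
      (∀ k μ u, ‖V₁ k μ u‖ ≤ α) → (∀ k μ u, μ ≠ μ₁ → V₁ k μ u = 0) → (∀ k (u : idx L M (k + 1)), V₁ (k + 1) μ₁ u = V₁ k μ₁ (parT (lev L k) L M u)) →
      (∀ k μ u, ‖V₂ k μ u‖ ≤ α) → (∀ k μ u, μ ≠ μ₂ → V₂ k μ u = 0) → (∀ k (u : idx L M (k + 1)), V₂ (k + 1) μ₂ u = V₂ k μ₂ (parT (lev L k) L M u)) →
      (∀ k μ u, V₁ k μ u ≠ 0 → rho L M k i u ≤ c₀) → (∀ k μ u, V₂ k μ u ≠ 0 → rho L M k j u ≤ c₀) →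
      (∀ k x y, ‖avgTow (QBlev L M) ((L : ℝ) ^ d)
          (fun k => calGlev L M a ha k * Pmodel L M V₁ k * (calGlev L M a ha k * Pmodel L M V₂ k * calGlev L M a ha k)) k x y‖
        ≤ B * Real.exp (-(κ * (distK L M x i + distK L M i j + distK L M y j)))) ∧
      (∀ k x y, ‖(avgTow (QBlev L M) ((L : ℝ) ^ d)
          (fun k => calGlev L M a ha k * Pmodel L M V₁ k * (calGlev L M a ha k * Pmodel L M V₂ k * calGlev L M a ha k)) (k + 1)
          - avgTow (QBlev L M) ((L : ℝ) ^ d)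
          (fun k => calGlev L M a ha k * Pmodel L M V₁ k * (calGlev L M a ha k * Pmodel L M V₂ k * calGlev L M a ha k)) k) x y‖
        ≤ B' * Real.sqrt ((L : ℝ)⁻¹) ^ k * Real.exp (-(κ * (distK L M x i + distK L M i j + distK L M y j)))) := by
  obtain ⟨κ, B, hκ0, hB, hUD⟩ := exists_threePoint_twoVertexWord L a ha α c₀ hα
  set C : ℝ := (α * Cst d a) * (α * Cst d a) * CJ d a + (Cst d a * α * (α * Cst d a) + Cst d a * α * Cst d a * α) * (CQL d a + 4 * d * Cst d a)
        + (α * Cst d a) * (α * Cst d a) * (d * L * Cst d a) + Cst d a * α * Cst d a * α * (d * L * Cst d a) with hCdef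
  have hL1 : (1 : ℝ) < L := by exact_mod_cast (lt_of_lt_of_le one_lt_two hL : 1 < L)
  have hρ0 : (0 : ℝ) ≤ (L : ℝ)⁻¹ := inv_nonneg.mpr (Nat.cast_nonneg _)
  have hρ1 : ((L : ℝ)⁻¹) < 1 := inv_lt_one_of_one_lt₀ hL1
  have hC0 : 0 ≤ max C 0 := le_max_right _ _
  refine ⟨κ / 2, B, Real.sqrt (2 * B * (2 * (max C 0) / (1 - (L : ℝ)⁻¹))), half_pos hκ0, hB, Real.sqrt_nonneg _,
    fun M _ i j μ₁ μ₂ V₁ V₂ hb₁ hd₁ hn₁ hb₂ hd₂ hn₂ hl₁ hl₂ => ?_⟩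
  have hT := towerLimitRate_nestedTwoWord L M a ha hL hα hb₁ hd₁ hn₁ hb₂ hd₂ hn₂
  have hT' : TowerLimitRate (QBlev L M) ((L : ℝ) ^ d)
      (fun k => calGlev L M a ha k * Pmodel L M V₁ k * (calGlev L M a ha k * Pmodel L M V₂ k * calGlev L M a ha k)) (max C 0) ((L : ℝ)⁻¹) := by
    obtain ⟨Xlim, hlim, hrate⟩ := hT
    refine ⟨Xlim, hlim, fun k => (hrate k).trans ?_⟩
    have h1 : 0 < 1 - (L : ℝ)⁻¹ := sub_pos.mpr hρ1
    exact div_le_div_of_nonneg_right (mul_le_mul_of_nonneg_right (le_max_left _ _) (pow_nonneg hρ0 k)) h1.le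
  have hdec : ∀ k, EntryDecay (fun x y => distK L M x i + distK L M i j + distK L M y j)
      (avgTow (QBlev L M) ((L : ℝ) ^ d) (fun k => calGlev L M a ha k * Pmodel L M V₁ k * (calGlev L M a ha k * Pmodel L M V₂ k * calGlev L M a ha k)) k) B κ :=
    fun k x y => hUD M i j V₁ V₂ hb₁ hb₂ hl₁ hl₂ k x y
  obtain ⟨clim, -, -, -, hstep⟩ := decayRate_of_towerLimitRate hρ0 hρ1 hC0 hT' hdec
  refine ⟨fun k x y => (hUD M i j V₁ V₂ hb₁ hb₂ hl₁ hl₂ k x y).trans (mul_le_mul_of_nonneg_left (Real.exp_le_exp.mpr ?_) hB), fun k x y => hstep k x y⟩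
  have h0 : 0 ≤ distK L M x i + distK L M i j + distK L M y j := add_nonneg (add_nonneg (distK_nonneg L M _ _) (distK_nonneg L M _ _)) (distK_nonneg L M _ _)
  nlinarith

end Summit.QuantumFields.BalabanUV.Beta.GAN24.NestedTwoVertexWordRate

end
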